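import Summits.NavierStokesRegularity.NavierStokesRegularity.Theorems.CircuitTrace.Negative.LoadBearing

/-!
# `CircuitTrace` (stmt-NavierStokesRegularity-1836), line `tilted-trace-gronwall`:
# the trace endgame (stub S6, `stub_traceEndgame`) is SHARP in the tilt — it fails at `β = 1/5`

Negative-side support (drefute seat). `TraceEndgameWithoutTilt` is the lead's registered stub
`stub_traceEndgame` (skeleton da3ad81a) with the strict tilt hypothesis `1/5 < β` weakened to `1/5 ≤ β`,
everything else verbatim. It is FALSE, by an explicit pure-real-analysis witness at `β = 1/5`
(`lam = 2`, `m = 1`, `δ = R = T = M = 1`, `Γ = 16`): an old low eddy `X₀ ≡ 1` (critical amplitude `1`,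
terminal trace `σ₀ = 1`) cushions the un-tilted low-block energy `L_N = Σ_{k≤N} Y_k²` from below, while
fronts `Y_k` (`Y = lam^{k/5}X`, critical units) ignite at level `1` at the Type-I-paced times
`t_k = 1 - 2^{-4k/5}` and burn out LINEARLY at rate `2·2^{4k/5}` — slow enough that
`t ↦ e^{16·2^{4N/5}t} L_N(t)` is non-decreasing for every `N` (the Grönwall hypothesis), fast enough that
every front is extinct before `T = 1` (traces `τ_k = 0`, `k ≥ 1`, so `Σσ³ = 1`). Paced fronts exist at
every scale `k ≥ 1`, contradicting the conclusion. With a tilt `β > 1/5` the same traces would have to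
satisfy `Σ_{k≤n} θ^{n-k}σ_k² ≥ c > 0` (`θ < 1`), which the cushion cannot supply: the tilt is exactly
what makes old low eddies forgettable (card `tilted-trace-gronwall`, Mechanism (4)).

No statement here asserts a `Theses` decl positively; nothing is assumed about a circuit. [folklore]
-/

noncomputable section

set_option linter.dupNamespace false

namespace Summit.NavierStokesRegularity.NavierStokesRegularity.Theorems.CircuitTrace.Negative

open Finset Real Set Filter Topology

/-- Stub S6 (`stub_traceEndgame`) of line `tilted-trace-gronwall` with `1/5 < β` weakened to `1/5 ≤ β`. -/
def TraceEndgameWithoutTilt : Prop :=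
    ∀ lam : ℝ, 1 < lam → ∀ β : ℝ, 1 / 5 ≤ β → ∀ (m : ℕ) (Γ δ R M T : ℝ) (X : Fin m → ℤ → ℝ → ℝ)
    (τ : Fin m → ℤ → ℝ), 0 < δ →
    (∀ (N : ℕ) (t₁ t₂ : ℝ), 0 < t₁ → t₁ ≤ t₂ → t₂ < T →
      Real.exp (-(Γ * lam ^ ((4 / 5 : ℝ) * N) * (t₂ - t₁))) *
          (∑ k ∈ Finset.range (N + 1), ∑ i : Fin m, lam ^ (2 * β * k) * (X i k t₁) ^ 2)
        ≤ ∑ k ∈ Finset.range (N + 1), ∑ i : Fin m, lam ^ (2 * β * k) * (X i k t₂) ^ 2) →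
    (∀ (i : Fin m) (n : ℤ), Filter.Tendsto (X i n) (nhdsWithin T (Set.Iio T)) (nhds (τ i n))) →
    (∀ s : Finset ℤ, ∑ n ∈ s, ∑ i : Fin m, (lam ^ ((1 / 5 : ℝ) * n) * |τ i n|) ^ 3 ≤ M) →
    ¬ (∀ n₀ : ℕ, ∃ n : ℕ, n₀ ≤ n ∧ ∃ i : Fin m, ∃ t ∈ Set.Ioo 0 T,
        lam ^ ((4 / 5 : ℝ) * n) * (T - t) ≤ R ∧ δ ≤ lam ^ ((1 / 5 : ℝ) * n) * |X i n t|)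

namespace EndgameTilt

/-! ### Elementary lemmas -/

/-- The two-branch exponential step: a function bounded below by `1` whose decrease over `[t₁,t₂]` is at
most `x` dominates `e^{-x}` times its initial value. -/
theorem exp_step {x L₁ L₂ : ℝ} (hx : 0 ≤ x) (h2 : 1 ≤ L₂) (hdrop : L₁ - x ≤ L₂) :
    Real.exp (-x) * L₁ ≤ L₂ := by
  have hE : 0 < Real.exp x := Real.exp_pos x
  have hEx : 1 + x ≤ Real.exp x := by linarith [Real.add_one_le_exp x]
  have hinv : Real.exp (-x) = (Real.exp x)⁻¹ := Real.exp_neg x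
  by_cases hL : L₁ ≤ Real.exp x
  · calc Real.exp (-x) * L₁ ≤ Real.exp (-x) * Real.exp x :=
          mul_le_mul_of_nonneg_left hL (Real.exp_pos _).le
      _ = 1 := by rw [← Real.exp_add]; simp
      _ ≤ L₂ := h2
  · push Not at hL
    -- L₁ (E - 1) ≥ E x ≥ x E, i.e. L₁/E ≤ L₁ - x
    have hkey : Real.exp (-x) * L₁ ≤ L₁ - x := by
      rw [hinv, inv_mul_le_iff₀ hE]
      nlinarith
    exact hkey.trans hdrop

/-- `2^{4/5} ≥ 3/2` (since `(3/2)^5 ≤ 2^4`). -/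
theorem three_halves_le_rpow : (3 / 2 : ℝ) ≤ (2 : ℝ) ^ (4 / 5 : ℝ) := by
  by_contra h
  push Not at h
  have h0 : 0 ≤ (2 : ℝ) ^ (4 / 5 : ℝ) := (Real.rpow_pos_of_pos (by norm_num) _).le
  have h5 : ((2 : ℝ) ^ (4 / 5 : ℝ)) ^ 5 < (3 / 2 : ℝ) ^ 5 := pow_lt_pow_left₀ h h0 (by norm_num)
  have h16 : ((2 : ℝ) ^ (4 / 5 : ℝ)) ^ 5 = 16 := by
    rw [← Real.rpow_natCast, ← Real.rpow_mul (by norm_num)]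
    norm_num
  rw [h16] at h5
  norm_num at h5

/-- The clock ratio `r = 2^{4/5}` and its powers `r^k = 2^{4k/5}`. -/
theorem rpow_succ (k : ℕ) :
    (2 : ℝ) ^ ((4 / 5 : ℝ) * ((k + 1 : ℕ) : ℝ)) = (2 : ℝ) ^ ((4 / 5 : ℝ) * k) * (2 : ℝ) ^ (4 / 5 : ℝ) := by
  rw [← Real.rpow_add (by norm_num : (0 : ℝ) < 2)]
  push_cast
  ring_nf

/-- Geometric bound: `Σ_{k ≤ N} 2^{4k/5} ≤ 4 · 2^{4N/5}`. -/
theorem geom_bound (N : ℕ) :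
    ∑ k ∈ Finset.range (N + 1), (2 : ℝ) ^ ((4 / 5 : ℝ) * k) ≤ 4 * (2 : ℝ) ^ ((4 / 5 : ℝ) * N) := by
  induction N with
  | zero => simp
  | succ n ih =>
    rw [Finset.sum_range_succ, rpow_succ]
    have hr := three_halves_le_rpow
    have hp : 0 ≤ (2 : ℝ) ^ ((4 / 5 : ℝ) * n) := (Real.rpow_pos_of_pos (by norm_num) _).le
    nlinarith

/-! ### The witness -/

/-- Ignition time of scale `k`: `t_k = 1 - 2^{-4k/5}` (Type-I pace `R = 1` towards `T = 1`). -/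
def tk (k : ℕ) : ℝ := 1 - (2 : ℝ) ^ (-((4 / 5 : ℝ) * k))

/-- Burn rate of scale `k`: `ρ_k = 2 · 2^{4k/5}`. -/
def rho (k : ℕ) : ℝ := 2 * (2 : ℝ) ^ ((4 / 5 : ℝ) * k)

/-- The front profile in critical units: off before `t_k`, ignites at level `1`, burns out linearly. -/
def front (k : ℕ) (t : ℝ) : ℝ := if t < tk k then 0 else max 0 (1 - rho k * (t - tk k))

/-- Critical-unit amplitudes: the cushion `Y₀ ≡ 1`, fronts at `k ≥ 1`, nothing below `0`. -/
def Y (n : ℤ) (t : ℝ) : ℝ := if n = 0 then 1 else if 0 < n then front n.toNat t else 0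

/-- The witness `X_{n}(t) = 2^{-n/5} Y_n(t)` (one mode per scale). -/
def Xw : Fin 1 → ℤ → ℝ → ℝ := fun _ n t => (2 : ℝ) ^ (-((1 / 5 : ℝ) * n)) * Y n t

/-- Its terminal trace: only the cushion survives. -/
def τw : Fin 1 → ℤ → ℝ := fun _ n => (2 : ℝ) ^ (-((1 / 5 : ℝ) * n)) * (if n = 0 then 1 else 0)

/-- Burn rates are positive. -/
theorem rho_pos (k : ℕ) : 0 < rho k := by
  unfold rho; exact mul_pos two_pos (Real.rpow_pos_of_pos (by norm_num) _)

/-- The front profile is non-negative. -/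
theorem front_nonneg (k : ℕ) (t : ℝ) : 0 ≤ front k t := by
  unfold front; split_ifs <;> simp

/-- The front profile never exceeds its ignition level `1`. -/
theorem front_le_one (k : ℕ) (t : ℝ) : front k t ≤ 1 := by
  unfold front
  split_ifs with h
  · exact zero_le_one
  · refine max_le zero_le_one ?_
    have : 0 ≤ rho k * (t - tk k) := mul_nonneg (rho_pos k).le (by linarith [not_lt.mp h])
    linarith

/-- One-sided Lipschitz bound of the squared profile: it never drops faster than `2ρ_k`. -/
theorem front_sq_drop (k : ℕ) {t₁ t₂ : ℝ} (h : t₁ ≤ t₂) :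
    front k t₁ ^ 2 - 2 * rho k * (t₂ - t₁) ≤ front k t₂ ^ 2 := by
  have hρ := (rho_pos k).le
  have hslack : 0 ≤ 2 * rho k * (t₂ - t₁) := by positivity
  by_cases h1 : t₁ < tk k
  · have : front k t₁ = 0 := by simp [front, h1]
    rw [this]
    nlinarith [sq_nonneg (front k t₂)]
  · have h2 : ¬ t₂ < tk k := fun h2 => h1 (lt_of_le_of_lt h h2)
    have e1 : front k t₁ = max 0 (1 - rho k * (t₁ - tk k)) := by simp [front, h1]
    have e2 : front k t₂ = max 0 (1 - rho k * (t₂ - tk k)) := by simp [front, h2]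
    have hg1 := front_nonneg k t₁
    have hg2 := front_nonneg k t₂
    have hl1 := front_le_one k t₁
    have hl2 := front_le_one k t₂
    -- g₁ ≤ g₂ + ρ (t₂ - t₁)
    have hlip : front k t₁ ≤ front k t₂ + rho k * (t₂ - t₁) := by
      rw [e1, e2]
      refine max_le ?_ ?_
      · have := le_max_left 0 (1 - rho k * (t₂ - tk k)); nlinarith
      · have := le_max_right 0 (1 - rho k * (t₂ - tk k)); nlinarith
    nlinarith

/-- The cushion. -/
theorem Y_zero (t : ℝ) : Y 0 t = 1 := by simp [Y]

/-- Positive scales carry fronts. -/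
theorem Y_pos {n : ℤ} (hn : 0 < n) (t : ℝ) : Y n t = front n.toNat t := by
  simp [Y, hn.ne', hn]

/-- Positive scales carry fronts (natural-number form). -/
theorem Y_natSucc (k : ℕ) (t : ℝ) : Y ((k + 1 : ℕ) : ℤ) t = front (k + 1) t := by
  rw [Y_pos (by omega)]
  simp

/-- Nothing below scale `0`. -/
theorem Y_neg {n : ℤ} (hn : n < 0) (t : ℝ) : Y n t = 0 := by
  simp [Y, hn.ne, not_lt.mpr hn.le]

/-- Squared drop of every `Y_k`, `k : ℕ`, is at most `2ρ_k (t₂ - t₁)`. -/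
theorem Y_sq_drop (k : ℕ) {t₁ t₂ : ℝ} (h : t₁ ≤ t₂) :
    Y k t₁ ^ 2 - 2 * rho k * (t₂ - t₁) ≤ Y k t₂ ^ 2 := by
  rcases k with _ | k
  · simp only [CharP.cast_eq_zero, Y_zero]
    have : 0 ≤ 2 * rho 0 * (t₂ - t₁) := by have := (rho_pos 0).le; nlinarith
    linarith
  · rw [Y_natSucc, Y_natSucc]
    exact front_sq_drop (k + 1) h

/-- The weights cancel: `2^{2·(1/5)·k} · (2^{-(1/5)k} y)² = y²`. -/
theorem weight_cancel (k : ℕ) (y : ℝ) :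
    (2 : ℝ) ^ (2 * (1 / 5 : ℝ) * k) * ((2 : ℝ) ^ (-((1 / 5 : ℝ) * ((k : ℤ) : ℝ))) * y) ^ 2 = y ^ 2 := by
  have h2 : (0 : ℝ) < 2 := by norm_num
  have : (2 : ℝ) ^ (2 * (1 / 5 : ℝ) * k) * ((2 : ℝ) ^ (-((1 / 5 : ℝ) * ((k : ℤ) : ℝ)))) ^ 2 = 1 := by
    rw [← Real.rpow_natCast ((2 : ℝ) ^ (-((1 / 5 : ℝ) * ((k : ℤ) : ℝ)))) 2, ← Real.rpow_mul h2.le,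
      ← Real.rpow_add h2]
    simp only [Int.cast_natCast, Nat.cast_ofNat]
    ring_nf
    exact Real.rpow_zero 2
  calc (2 : ℝ) ^ (2 * (1 / 5 : ℝ) * k) * ((2 : ℝ) ^ (-((1 / 5 : ℝ) * ((k : ℤ) : ℝ))) * y) ^ 2
      = ((2 : ℝ) ^ (2 * (1 / 5 : ℝ) * k) * ((2 : ℝ) ^ (-((1 / 5 : ℝ) * ((k : ℤ) : ℝ)))) ^ 2) * y ^ 2 := by
        ring
    _ = y ^ 2 := by rw [this, one_mul]

/-- Critical amplitude of the witness is `|Y|`: `2^{(1/5)a} |2^{-(1/5)a} y| = |y|`. -/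
theorem crit_cancel (a y : ℝ) :
    (2 : ℝ) ^ ((1 / 5 : ℝ) * a) * |(2 : ℝ) ^ (-((1 / 5 : ℝ) * a)) * y| = |y| := by
  have h2 : (0 : ℝ) < 2 := by norm_num
  have hp : 0 < (2 : ℝ) ^ (-((1 / 5 : ℝ) * a)) := Real.rpow_pos_of_pos h2 _
  rw [abs_mul, abs_of_pos hp, ← mul_assoc, ← Real.rpow_add h2]
  simp

/-- The un-tilted low-block energy of the witness is `Σ_{k≤N} Y_k²`. -/
theorem blockEnergy_eq (N : ℕ) (t : ℝ) :
    ∑ k ∈ Finset.range (N + 1), ∑ i : Fin 1, (2 : ℝ) ^ (2 * (1 / 5 : ℝ) * k) * (Xw i k t) ^ 2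
      = ∑ k ∈ Finset.range (N + 1), Y k t ^ 2 := by
  refine Finset.sum_congr rfl fun k _ => ?_
  simp only [Finset.univ_unique, Fin.default_eq_zero, Finset.sum_singleton, Xw]
  exact weight_cancel k (Y k t)

/-- The cushion: `Σ_{k≤N} Y_k² ≥ 1`. -/
theorem one_le_blockEnergy (N : ℕ) (t : ℝ) : 1 ≤ ∑ k ∈ Finset.range (N + 1), Y k t ^ 2 := by
  have h0 : (0 : ℕ) ∈ Finset.range (N + 1) := by simp
  have := Finset.single_le_sum (f := fun k : ℕ => Y k t ^ 2) (fun k _ => sq_nonneg _) h0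
  simpa [Y_zero] using this

/-- The Grönwall hypothesis of S6 holds for the witness at `β = 1/5`, `Γ = 16`. -/
theorem gronwall_witness (N : ℕ) {t₁ t₂ : ℝ} (h : t₁ ≤ t₂) :
    Real.exp (-(16 * (2 : ℝ) ^ ((4 / 5 : ℝ) * N) * (t₂ - t₁))) *
        (∑ k ∈ Finset.range (N + 1), ∑ i : Fin 1, (2 : ℝ) ^ (2 * (1 / 5 : ℝ) * k) * (Xw i k t₁) ^ 2)
      ≤ ∑ k ∈ Finset.range (N + 1), ∑ i : Fin 1, (2 : ℝ) ^ (2 * (1 / 5 : ℝ) * k) * (Xw i k t₂) ^ 2 := by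
  rw [blockEnergy_eq, blockEnergy_eq]
  have hx : 0 ≤ 16 * (2 : ℝ) ^ ((4 / 5 : ℝ) * N) * (t₂ - t₁) := by
    have := (Real.rpow_pos_of_pos (by norm_num : (0 : ℝ) < 2) ((4 / 5 : ℝ) * N)).le
    nlinarith
  refine exp_step hx (one_le_blockEnergy N t₂) ?_
  -- total drop ≤ Σ 2ρ_k (t₂ - t₁) = 4 (Σ 2^{4k/5}) (t₂ - t₁) ≤ 16 · 2^{4N/5} (t₂ - t₁)
  have hdrop : ∑ k ∈ Finset.range (N + 1), Y k t₁ ^ 2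
      - (∑ k ∈ Finset.range (N + 1), 2 * rho k) * (t₂ - t₁)
      ≤ ∑ k ∈ Finset.range (N + 1), Y k t₂ ^ 2 := by
    rw [Finset.sum_mul, ← Finset.sum_sub_distrib]
    exact Finset.sum_le_sum fun k _ => by
      have := Y_sq_drop k h
      nlinarith
  have hsum : (∑ k ∈ Finset.range (N + 1), 2 * rho k) * (t₂ - t₁)
      ≤ 16 * (2 : ℝ) ^ ((4 / 5 : ℝ) * N) * (t₂ - t₁) := by
    have hg := geom_bound N
    have : ∑ k ∈ Finset.range (N + 1), 2 * rho k
        = 4 * ∑ k ∈ Finset.range (N + 1), (2 : ℝ) ^ ((4 / 5 : ℝ) * k) := by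
      rw [Finset.mul_sum]
      refine Finset.sum_congr rfl fun k _ => ?_
      unfold rho; ring
    rw [this]
    have ht : 0 ≤ t₂ - t₁ := by linarith
    nlinarith
  linarith

/-- Before `T = 1` every front at scale `k ≥ 1` is extinct: for `t ∈ (t_k + 2^{-4k/5}/2, 1)`,
`front k t = 0`. -/
theorem front_extinct (k : ℕ) {t : ℝ} (ht : tk k + (2 : ℝ) ^ (-((4 / 5 : ℝ) * k)) / 2 < t) :
    front k t = 0 := by
  have h2 : (0 : ℝ) < 2 := by norm_num
  have hq : 0 < (2 : ℝ) ^ (-((4 / 5 : ℝ) * k)) := Real.rpow_pos_of_pos h2 _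
  have hnot : ¬ t < tk k := by intro h; linarith
  have hprod : rho k * ((2 : ℝ) ^ (-((4 / 5 : ℝ) * k)) / 2) = 1 := by
    unfold rho
    rw [Real.rpow_neg h2.le]
    field_simp
  have hle : 1 - rho k * (t - tk k) ≤ 0 := by
    have : rho k * ((2 : ℝ) ^ (-((4 / 5 : ℝ) * k)) / 2) < rho k * (t - tk k) :=
      mul_lt_mul_of_pos_left (by linarith) (rho_pos k)
    linarith
  simp [front, hnot, max_eq_left hle]

/-- Ignition happens before `T = 1`. -/
theorem tk_lt_one (k : ℕ) : tk k < 1 := by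
  unfold tk
  have := Real.rpow_pos_of_pos (by norm_num : (0 : ℝ) < 2) (-((4 / 5 : ℝ) * k))
  linarith

/-- Ignition happens after time `0` (scales `k ≥ 1`). -/
theorem tk_pos {k : ℕ} (hk : 1 ≤ k) : 0 < tk k := by
  unfold tk
  have : (2 : ℝ) ^ (-((4 / 5 : ℝ) * k)) < 1 := by
    apply Real.rpow_lt_one_of_one_lt_of_neg (by norm_num)
    have : (1 : ℝ) ≤ k := by exact_mod_cast hk
    nlinarith
  linarith

/-- Extinction happens before `T = 1`. -/
theorem extinct_time_lt_one (k : ℕ) : tk k + (2 : ℝ) ^ (-((4 / 5 : ℝ) * k)) / 2 < 1 := by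
  unfold tk
  have := Real.rpow_pos_of_pos (by norm_num : (0 : ℝ) < 2) (-((4 / 5 : ℝ) * k))
  linarith

/-- Terminal traces of the witness. -/
theorem tendsto_witness (i : Fin 1) (n : ℤ) :
    Tendsto (Xw i n) (𝓝[<] (1 : ℝ)) (𝓝 (τw i n)) := by
  rcases lt_trichotomy n 0 with hn | rfl | hn
  · have : Xw i n = fun _ => 0 := by funext t; simp [Xw, Y_neg hn]
    have hτ : τw i n = 0 := by simp [τw, hn.ne]
    rw [this, hτ]; exact tendsto_const_nhds
  · have : Xw i 0 = fun _ => (2 : ℝ) ^ (-((1 / 5 : ℝ) * ((0 : ℤ) : ℝ))) * 1 := by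
      funext t; simp [Xw, Y_zero]
    have hτ : τw i 0 = (2 : ℝ) ^ (-((1 / 5 : ℝ) * ((0 : ℤ) : ℝ))) * 1 := by simp [τw]
    rw [this, hτ]; exact tendsto_const_nhds
  · obtain ⟨k, rfl⟩ := Int.eq_ofNat_of_zero_le hn.le
    have hk : 1 ≤ k := by exact_mod_cast hn
    have hk0 : k ≠ 0 := by omega
    have hτ : τw i (k : ℤ) = 0 := by simp [τw, hk0]
    rw [hτ]
    refine (tendsto_const_nhds (x := (0 : ℝ))).congr' ?_
    have hmem : Set.Ioo (tk k + (2 : ℝ) ^ (-((4 / 5 : ℝ) * k)) / 2) 1 ∈ 𝓝[<] (1 : ℝ) :=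
      Ioo_mem_nhdsLT (extinct_time_lt_one k)
    filter_upwards [hmem] with t ht
    rw [Xw, Y_pos hn, Int.toNat_natCast, front_extinct k ht.1, mul_zero]

/-- The trace is `ℓ³`-bounded by `M = 1` in critical units (only the cushion is non-zero). -/
theorem trace_l3 (s : Finset ℤ) :
    ∑ n ∈ s, ∑ i : Fin 1, ((2 : ℝ) ^ ((1 / 5 : ℝ) * n) * |τw i n|) ^ 3 ≤ 1 := by
  have hterm : ∀ n : ℤ, ∑ i : Fin 1, ((2 : ℝ) ^ ((1 / 5 : ℝ) * n) * |τw i n|) ^ 3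
      = if n = 0 then 1 else 0 := by
    intro n
    simp only [Finset.univ_unique, Fin.default_eq_zero, Finset.sum_singleton, τw, crit_cancel]
    split_ifs <;> simp
  rw [Finset.sum_congr rfl fun n _ => hterm n, Finset.sum_ite_eq' s (0 : ℤ) (fun _ => (1 : ℝ))]
  split_ifs <;> norm_num

/-- Paced fronts exist at every scale `k ≥ 1`. -/
theorem fronts_witness (n₀ : ℕ) : ∃ n : ℕ, n₀ ≤ n ∧ ∃ i : Fin 1, ∃ t ∈ Set.Ioo (0 : ℝ) 1,
    (2 : ℝ) ^ ((4 / 5 : ℝ) * n) * (1 - t) ≤ 1 ∧ 1 ≤ (2 : ℝ) ^ ((1 / 5 : ℝ) * n) * |Xw i n t| := by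
  have h2 : (0 : ℝ) < 2 := by norm_num
  refine ⟨n₀ + 1, by omega, 0, tk (n₀ + 1), ⟨tk_pos (by omega), tk_lt_one _⟩, ?_, ?_⟩
  · unfold tk
    rw [sub_sub_cancel, ← Real.rpow_add h2]
    simp
  · have hY : Y ((n₀ + 1 : ℕ) : ℤ) (tk (n₀ + 1)) = 1 := by
      rw [Y_natSucc]
      simp [front]
    rw [Xw, hY]
    simp only [Int.cast_natCast]
    rw [crit_cancel]
    simp

end EndgameTilt

open EndgameTilt in
/-- **S6 is sharp in the tilt.** With `1/5 < β` weakened to `1/5 ≤ β` the trace endgame is false. -/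
theorem traceEndgame_false_without_tilt : ¬ TraceEndgameWithoutTilt := by
  intro h
  have := h 2 (by norm_num) (1 / 5) le_rfl 1 16 1 1 1 1 Xw τw one_pos
    (fun N t₁ t₂ _ ht _ => by
      have := gronwall_witness N ht
      simpa [Nat.cast_ofNat] using this)
    tendsto_witness trace_l3
  exact this fronts_witness

end Summit.NavierStokesRegularity.NavierStokesRegularity.Theorems.CircuitTrace.Negative

end
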